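import Mathlib
import Summits.Ventures.PercRepro2.Defs
import Summits.Ventures.PercRepro2.Independence
import Summits.Ventures.PercRepro2.Graph
import Summits.Ventures.PercRepro2.HubModel
import Summits.Ventures.PercRepro2.HubModel3
import Summits.Ventures.PercRepro2.HubLaw3
import Summits.Ventures.PercRepro2.EdgeBundles

/-!
# The law of the a₃-bundle state is a product of Bernoulli laws
(blind cell PercRepro2, mine-2 g15; MINE2-A3FIRST.md §3 — the (S3) piece of the a₃-hub)

The `i`-th a₃ bundle `bundleEdges3 ends μ i` is the finset of edges joining `μ a₃` to the mark
`μ (bundle3 i).2` (`o, b, a₁, a₂`). For an injective marking the four bundles are pairwise disjoint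
(`bundleEdges3_disjoint`), the bundle state is the vector of «some edge of the bundle is open»
(`a3State_eq_iff`), and therefore (`EdgeBundles.prob_bundleState_eq_prod`)

  `P(a3State = w) = ∏_i q_i^{w_i} (1 − q_i)^{1 − w_i}`,   `q_i = 1 − ∏_{e ∈ bundle i} (1 − p e)`

(`prob_a3State_eq`, `prob_a3State_eq_prod_pow`): the a₃-edge weights enter the hub law only through
the four effective bundle weights `q_i` — the Bernstein variables of the a₃-hub table.
-/

namespace Summit.Ventures.PercRepro2.Hub3

open Hub Bundles

variable {V : Type*} {E : Type*} [Fintype E] [DecidableEq E] [DecidableEq V]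

/-- The edges of the `i`-th a₃ bundle: those joining `μ a₃` to the bundle's mark. -/
def bundleEdges3 (ends : E → Sym2 V) (μ : Mark → V) (i : Fin 4) : Finset E :=
  Finset.univ.filter fun e => ends e = s(μ (bundle3 i).1, μ (bundle3 i).2)

/-- The bundles' marks are the four marks other than `a₃`, pairwise distinct. -/
lemma bundle3_snd_injective : Function.Injective fun i : Fin 4 => (bundle3 i).2 := by
  intro i j h
  fin_cases i <;> fin_cases j <;> simp_all [bundle3]

/-- The first mark of every bundle is `a₃` (as an equation). -/
lemma bundle3_fst (i : Fin 4) : (bundle3 i).1 = .a₃ := by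
  fin_cases i <;> rfl

/-- The bundle's second mark is not `a₃`. -/
lemma bundle3_snd_ne (i : Fin 4) : (bundle3 i).2 ≠ .a₃ := by
  fin_cases i <;> simp [bundle3]

omit [DecidableEq E] in
/-- Two distinct bundles share no edge (injective marking). -/
lemma bundleEdges3_disjoint (ends : E → Sym2 V) {μ : Mark → V}
    (hinj : Function.Injective μ) (i j : Fin 4) (hij : i ≠ j) :
    Disjoint (bundleEdges3 ends μ i) (bundleEdges3 ends μ j) := by
  rw [Finset.disjoint_left]
  intro e hi hj
  simp only [bundleEdges3, Finset.mem_filter, Finset.mem_univ, true_and] at hi hj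
  rw [hi, bundle3_fst, bundle3_fst] at hj
  rw [Sym2.eq_iff] at hj
  rcases hj with ⟨_, h2⟩ | ⟨h1, h2⟩
  · exact hij (bundle3_snd_injective (hinj h2))
  · exact bundle3_snd_ne j (hinj h1).symm

omit [DecidableEq E] in
/-- Open adjacency along a bundle is «some edge of the bundle is open». -/
lemma openAdj_iff_someOpen (ends : E → Sym2 V) (μ : Mark → V) (ω : Config E) (i : Fin 4) :
    OpenAdj ends ω (μ (bundle3 i).1) (μ (bundle3 i).2) ↔ ω ∈ someOpen (bundleEdges3 ends μ i) := by
  rw [mem_someOpen]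
  constructor
  · rintro ⟨e, he, hends⟩
    exact ⟨e, by simp [bundleEdges3, hends], he⟩
  · rintro ⟨e, he, hω⟩
    simp only [bundleEdges3, Finset.mem_filter, Finset.mem_univ, true_and] at he
    exact ⟨e, hω, he⟩

omit [DecidableEq E] in
/-- **The bundle state as a bundle event**: `a3State ω = w ↔ ω ∈ ⋂ i, bundleEvent (bundle i) (w i)`. -/
lemma a3State_eq_iff (ends : E → Sym2 V) (μ : Mark → V) (ω : Config E) (w : Fin 4 → Bool) :
    a3State ends μ ω = w ↔ ω ∈ ⋂ i, bundleEvent (bundleEdges3 ends μ i) (w i) := by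
  simp only [Set.mem_iInter]
  constructor
  · intro h i
    have hi : a3State ends μ ω i = w i := by rw [h]
    unfold a3State at hi
    cases hw : w i
    · rw [hw] at hi
      simp only [decide_eq_false_iff_not] at hi
      simp only [bundleEvent, Bool.false_eq_true, ite_false, Set.mem_compl_iff]
      rw [← openAdj_iff_someOpen]
      exact hi
    · rw [hw] at hi
      simp only [decide_eq_true_eq] at hi
      simp only [bundleEvent, ite_true]
      rw [← openAdj_iff_someOpen]
      exact hi
  · intro h
    funext i
    have hi := h i
    unfold a3State
    cases hw : w i
    · rw [hw] at hi
      simp only [bundleEvent, Bool.false_eq_true, ite_false, Set.mem_compl_iff] at hi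
      rw [← openAdj_iff_someOpen] at hi
      simp only [decide_eq_false_iff_not]
      exact hi
    · rw [hw] at hi
      simp only [bundleEvent, ite_true] at hi
      rw [← openAdj_iff_someOpen] at hi
      simp only [decide_eq_true_eq]
      exact hi

variable {R : Type*} [CommRing R]

/-- **The law of the a₃-bundle state** is the product of the bundle laws. -/
theorem prob_a3State_eq (p : E → R) (ends : E → Sym2 V) {μ : Mark → V}
    (hinj : Function.Injective μ) (w : Fin 4 → Bool) :
    prob p {ω | a3State ends μ ω = w} =
      ∏ i, (if w i then prob p (someOpen (bundleEdges3 ends μ i))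
        else 1 - prob p (someOpen (bundleEdges3 ends μ i))) := by
  have e : {ω | a3State ends μ ω = w} = ⋂ i, bundleEvent (bundleEdges3 ends μ i) (w i) := by
    ext ω
    exact a3State_eq_iff ends μ ω w
  rw [e]
  exact prob_bundleState_eq_prod p (fun i => bundleEdges3 ends μ i)
    (fun i j hij => bundleEdges3_disjoint ends hinj i j hij) w

/-- The effective weight of the `i`-th bundle: `q_i = 1 − ∏_{e ∈ bundle i} (1 − p e)`. -/
noncomputable def bundleWeight3 (p : E → R) (ends : E → Sym2 V) (μ : Mark → V) (i : Fin 4) : R :=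
  1 - ∏ e ∈ bundleEdges3 ends μ i, (1 - p e)

/-- **`P(a3State = w) = ∏_i q_i^{w_i} (1 − q_i)^{1 − w_i}`** with the effective bundle weights. -/
theorem prob_a3State_eq_prod_pow (p : E → R) (ends : E → Sym2 V) {μ : Mark → V}
    (hinj : Function.Injective μ) (w : Fin 4 → Bool) :
    prob p {ω | a3State ends μ ω = w} =
      ∏ i, (if w i then bundleWeight3 p ends μ i else 1 - bundleWeight3 p ends μ i) := by
  rw [prob_a3State_eq p ends hinj w]
  refine Finset.prod_congr rfl fun i _ => ?_
  rw [prob_someOpen]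
  rfl

end Summit.Ventures.PercRepro2.Hub3
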